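import Mathlib
import HarnessLib
import Summits.Ventures.LatticeQCDFlow.Scaling.AutoregressiveGaugeColdEscapeRatio

/-!
# LatticeQCDFlow / Scaling — the closing assignment induced by a closing map of maximal rank is NORMALISED:
# positions from the ranks, `∫ ∏_ℓ (∏_{p∈C_ℓ} w(U_p))/N_ℓ(U) dHaar^{⊗E} = 1`, so its proposal is a probability law

HONEST FRAMING: exact (Metropolis-corrected) sampling algorithms for lattice gauge theory;
figures of merit are autocorrelation/cost numbers at stated couplings and volumes; no
continuum-physics claim.

Venture `LatticeQCDFlow` (cell pub-lqcd), topic `Scaling`, FANOUT row 30 (lean-1, GEN-28) — OUR WORK on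
THEORY-2.md §4 row C5.  `AutoregressiveGaugeColdEscapeRatio` ∕ `…ColdEscapeSeparation` ∕ `…ColdStartLaw`
compare the one-plaquette heat bath with the all-closing conditioner along the closing assignment INDUCED by a
total closing map `u` (`T = t(B)`, `C_{t(a)} = {a} ∪ u⁻¹(a)`), taking the all-closing proposal `q` as a
probability law by hypothesis (the tree's convention, `AutoregressiveGaugeAllClosingScorecard`).  Here that
hypothesis is DISCHARGED for closing maps of maximal rank (the ones
`AutoregressiveGaugeHeatBathClosingMapFloor.exists_closingMap_of_optimal` produces):

* **`induced_positions_lt`** — with positions `pos(e) = rank(b) + 1` if `e = t(b)` is a top link (`b ∈ B`,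
  unique by injectivity) and `pos(e) = 0` otherwise (written as a `Finset.sup`), every link `e ≠ t(a)` of a
  plaquette of `C_{t(a)}` has `pos(e) < pos(t(a))`: for `a` itself by the ranking, for `p' ∈ u⁻¹(a)` by the
  maximality of the closer (`humax`);
* **`integral_induced_allClosing_eq_one`** — hence `AutoregressiveGaugeAllClosingHeatBath.integral_prod_allClosing_conditioner_eq_one`
  applies: the induced all-closing autoregression integrates to `1`;
* **`isProbabilityMeasure_induced`** — its proposal `q = (∏_ℓ (∏_{p∈C_ℓ} w)/N_ℓ)·Haar^{⊗E}` IS a probability law.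

No `def`, no `sorry`, nothing cited as a fact beyond the tree.
-/

noncomputable section

namespace Summit.Ventures.LatticeQCDFlow.Theory2.Autoregressive

open MeasureTheory ProbabilityTheory Function Finset
open scoped ENNReal
open Literature.MathematicalPhysics.QuantumFieldTheory Literature.MathematicalPhysics.QuantumLattice
open Summit.Ventures.LatticeQCDFlow.Exactness Summit.Ventures.LatticeQCDFlow.Scoring

variable {d L : ℕ} [NeZero L]

/-! ## §1 Positions from the ranks -/

omit [NeZero L] in
/-- The position of a top link `t(b)`, `b ∈ B`, is `rank(b) + 1` (injectivity of `t` on `B`). [ours] -/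
theorem sup_filter_top_eq (B : Finset (Plaquette d L)) (t : Plaquette d L → Edge d L) (rank : Plaquette d L → ℕ)
    (hinj : Set.InjOn t B) {b : Plaquette d L} (hb : b ∈ B) :
    (B.filter (fun b' => t b' = t b)).sup (fun b' => rank b' + 1) = rank b + 1 := by
  have hfilter : B.filter (fun b' => t b' = t b) = {b} := by
    ext b'
    simp only [Finset.mem_filter, Finset.mem_singleton]
    exact ⟨fun h => hinj h.1 hb h.2, fun h => by subst h; exact ⟨hb, rfl⟩⟩
  rw [hfilter, Finset.sup_singleton]

omit [NeZero L] in
/-- The position of a link that is no top link is `0`. [ours] -/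
theorem sup_filter_eq_zero_of_forall_ne (B : Finset (Plaquette d L)) (t : Plaquette d L → Edge d L)
    (rank : Plaquette d L → ℕ) {e : Edge d L} (he : ∀ b ∈ B, t b ≠ e) :
    (B.filter (fun b' => t b' = e)).sup (fun b' => rank b' + 1) = 0 := by
  have hfilter : B.filter (fun b' => t b' = e) = ∅ :=
    Finset.filter_eq_empty_iff.2 fun b hb h => he b hb h
  rw [hfilter, Finset.sup_empty, bot_eq_zero]

/-- **POSITIONS FOR THE INDUCED ASSIGNMENT.**  `(B, t, rank)` ranked, `u : Bᶜ → B` a closing map of maximal rank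
(`t(u p')` a link of `p'`; every other covered plaquette whose top link lies on `p'` has smaller rank).  Then every
link `e ≠ ℓ` of a plaquette of `C_ℓ` has smaller position than `ℓ`, for every closing link `ℓ ∈ t(B)`. [ours] -/
theorem induced_positions_lt (B : Finset (Plaquette d L)) (t : Plaquette d L → Edge d L)
    (ht : ∀ p ∈ B, t p ∈ ({(p.1, p.2.1.1), (p.1.shift p.2.1.1, p.2.1.2),
        (p.1.shift p.2.1.2, p.2.1.1), (p.1, p.2.1.2)} : Finset (Edge d L)))
    (rank : Plaquette d L → ℕ)
    (hrank : ∀ p ∈ B, ∀ p' ∈ B, p ≠ p' → t p ∈ ({(p'.1, p'.2.1.1), (p'.1.shift p'.2.1.1, p'.2.1.2),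
        (p'.1.shift p'.2.1.2, p'.2.1.1), (p'.1, p'.2.1.2)} : Finset (Edge d L)) → rank p < rank p')
    (u : Plaquette d L → Plaquette d L) (huB : ∀ p' ∈ Finset.univ \ B, u p' ∈ B)
    (humax : ∀ p' ∈ Finset.univ \ B, ∀ p ∈ B, p ≠ u p' → t p ∈ ({(p'.1, p'.2.1.1), (p'.1.shift p'.2.1.1, p'.2.1.2),
        (p'.1.shift p'.2.1.2, p'.2.1.1), (p'.1, p'.2.1.2)} : Finset (Edge d L)) → rank p < rank (u p')) :
    ∀ ℓ ∈ B.image t, ∀ p ∈ B.filter (fun b => t b = ℓ) ∪ (Finset.univ \ B).filter (fun p' => t (u p') = ℓ),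
      ∀ e ∈ ({(p.1, p.2.1.1), (p.1.shift p.2.1.1, p.2.1.2), (p.1.shift p.2.1.2, p.2.1.1), (p.1, p.2.1.2)} :
        Finset (Edge d L)), e ≠ ℓ →
        (B.filter (fun b' => t b' = e)).sup (fun b' => rank b' + 1) <
          (B.filter (fun b' => t b' = ℓ)).sup (fun b' => rank b' + 1) := by
  classical
  have hinj : Set.InjOn t B := injOn_of_ranked B t ht rank hrank
  intro ℓ hℓ p hp e he hne
  obtain ⟨a, ha, rfl⟩ := Finset.mem_image.1 hℓ
  rw [induced_closing_eq B t u hinj huB ha, Finset.mem_insert] at hp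
  rw [sup_filter_top_eq B t rank hinj ha]
  by_cases htop : ∃ b ∈ B, t b = e
  · obtain ⟨b, hb, rfl⟩ := htop
    rw [sup_filter_top_eq B t rank hinj hb]
    have hba : b ≠ a := fun h => hne (by rw [h])
    rcases hp with rfl | hp
    · exact Nat.succ_lt_succ (hrank b hb p ha hba he)
    · obtain ⟨hp', hpu⟩ := Finset.mem_filter.1 hp
      have h := humax p hp' b hb (by rw [hpu]; exact hba) he
      rw [hpu] at h
      exact Nat.succ_lt_succ h
  · push Not at htop
    rw [sup_filter_eq_zero_of_forall_ne B t rank htop]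
    exact Nat.succ_pos _

/-! ## §2 The induced autoregression is normalised -/

section Haar

variable {G : Type*} [Group G] [TopologicalSpace G] [IsTopologicalGroup G]
  [CompactSpace G] [SecondCountableTopology G] [MeasurableSpace G] [BorelSpace G]

/-- **THE INDUCED ALL-CLOSING AUTOREGRESSION IS NORMALISED**: `∫ ∏_{ℓ∈t(B)} (∏_{p∈C_ℓ} w(U_p))/N_ℓ(U) dHaar^{⊗E} = 1`
for a closing map of maximal rank. [ours] -/
theorem integral_induced_allClosing_eq_one {w : G → ℝ} (hw : Continuous w) {m M : ℝ} (hm0 : 0 < m)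
    (hm : ∀ g, m ≤ w g) (hM : ∀ g, w g ≤ M)
    (B : Finset (Plaquette d L)) (t : Plaquette d L → Edge d L)
    (ht : ∀ p ∈ B, t p ∈ ({(p.1, p.2.1.1), (p.1.shift p.2.1.1, p.2.1.2),
        (p.1.shift p.2.1.2, p.2.1.1), (p.1, p.2.1.2)} : Finset (Edge d L)))
    (rank : Plaquette d L → ℕ)
    (hrank : ∀ p ∈ B, ∀ p' ∈ B, p ≠ p' → t p ∈ ({(p'.1, p'.2.1.1), (p'.1.shift p'.2.1.1, p'.2.1.2),
        (p'.1.shift p'.2.1.2, p'.2.1.1), (p'.1, p'.2.1.2)} : Finset (Edge d L)) → rank p < rank p')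
    (u : Plaquette d L → Plaquette d L) (huB : ∀ p' ∈ Finset.univ \ B, u p' ∈ B)
    (humax : ∀ p' ∈ Finset.univ \ B, ∀ p ∈ B, p ≠ u p' → t p ∈ ({(p'.1, p'.2.1.1), (p'.1.shift p'.2.1.1, p'.2.1.2),
        (p'.1.shift p'.2.1.2, p'.2.1.1), (p'.1, p'.2.1.2)} : Finset (Edge d L)) → rank p < rank (u p')) :
    ∫ U, ∏ ℓ ∈ B.image t,
        (∏ p ∈ B.filter (fun b => t b = ℓ) ∪ (Finset.univ \ B).filter (fun p' => t (u p') = ℓ),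
            w (plaquetteHolonomy U p.1 p.2.1.1 p.2.1.2)) /
          (∫ v, ∏ p ∈ B.filter (fun b => t b = ℓ) ∪ (Finset.univ \ B).filter (fun p' => t (u p') = ℓ),
            w (plaquetteHolonomy (update U ℓ v) p.1 p.2.1.1 p.2.1.2) ∂(haarProbability G))
      ∂(Measure.pi fun _ : Edge d L => haarProbability G) = 1 :=
  integral_prod_allClosing_conditioner_eq_one hw hm0 hm hM (B.image t)
    (fun e => (B.filter (fun b' => t b' = e)).sup (fun b' => rank b' + 1))
    (fun ℓ => B.filter (fun b => t b = ℓ) ∪ (Finset.univ \ B).filter (fun p' => t (u p') = ℓ))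
    (induced_positions_lt B t ht rank hrank u huB humax)

/-- **… so the induced all-closing proposal is a probability law.** [ours] -/
theorem isProbabilityMeasure_induced {w : G → ℝ} (hw : Continuous w) {m M : ℝ} (hm0 : 0 < m)
    (hm : ∀ g, m ≤ w g) (hM : ∀ g, w g ≤ M)
    (B : Finset (Plaquette d L)) (t : Plaquette d L → Edge d L)
    (ht : ∀ p ∈ B, t p ∈ ({(p.1, p.2.1.1), (p.1.shift p.2.1.1, p.2.1.2),
        (p.1.shift p.2.1.2, p.2.1.1), (p.1, p.2.1.2)} : Finset (Edge d L)))
    (rank : Plaquette d L → ℕ)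
    (hrank : ∀ p ∈ B, ∀ p' ∈ B, p ≠ p' → t p ∈ ({(p'.1, p'.2.1.1), (p'.1.shift p'.2.1.1, p'.2.1.2),
        (p'.1.shift p'.2.1.2, p'.2.1.1), (p'.1, p'.2.1.2)} : Finset (Edge d L)) → rank p < rank p')
    (u : Plaquette d L → Plaquette d L) (huB : ∀ p' ∈ Finset.univ \ B, u p' ∈ B)
    (humax : ∀ p' ∈ Finset.univ \ B, ∀ p ∈ B, p ≠ u p' → t p ∈ ({(p'.1, p'.2.1.1), (p'.1.shift p'.2.1.1, p'.2.1.2),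
        (p'.1.shift p'.2.1.2, p'.2.1.1), (p'.1, p'.2.1.2)} : Finset (Edge d L)) → rank p < rank (u p')) :
    IsProbabilityMeasure ((Measure.pi fun _ : Edge d L => haarProbability G).withDensity fun U =>
      ENNReal.ofReal (∏ ℓ ∈ B.image t,
        (∏ p ∈ B.filter (fun b => t b = ℓ) ∪ (Finset.univ \ B).filter (fun p' => t (u p') = ℓ),
            w (plaquetteHolonomy U p.1 p.2.1.1 p.2.1.2)) /
          (∫ v, ∏ p ∈ B.filter (fun b => t b = ℓ) ∪ (Finset.univ \ B).filter (fun p' => t (u p') = ℓ),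
            w (plaquetteHolonomy (update U ℓ v) p.1 p.2.1.1 p.2.1.2) ∂(haarProbability G)))) := by
  classical
  set Haar : Measure (GaugeConfig d L G) := Measure.pi fun _ : Edge d L => haarProbability G with hHaar
  set C : Edge d L → Finset (Plaquette d L) :=
    fun ℓ => B.filter (fun b => t b = ℓ) ∪ (Finset.univ \ B).filter (fun p' => t (u p') = ℓ) with hC
  set f : GaugeConfig d L G → ℝ := fun U => ∏ ℓ ∈ B.image t,
      (∏ p ∈ C ℓ, w (plaquetteHolonomy U p.1 p.2.1.1 p.2.1.2)) /
        (∫ v, ∏ p ∈ C ℓ, w (plaquetteHolonomy (update U ℓ v) p.1 p.2.1.1 p.2.1.2) ∂(haarProbability G)) with hf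
  have hw0 : ∀ g, 0 < w g := fun g => hm0.trans_le (hm g)
  have hMpos : 0 < M := (hw0 1).trans_le (hM 1)
  haveI : IsProbabilityMeasure Haar := by rw [hHaar]; infer_instance
  have hNpos : ∀ (ℓ : Edge d L) (U : GaugeConfig d L G),
      0 < ∫ v, ∏ p ∈ C ℓ, w (plaquetteHolonomy (update U ℓ v) p.1 p.2.1.1 p.2.1.2) ∂(haarProbability G) :=
    fun ℓ U => lt_of_lt_of_le (pow_pos hm0 _) (pow_le_normaliser_le_pow hw hm0 hm hM (C ℓ) ℓ U).1
  have hfpos : ∀ U, 0 < f U := fun U => prod_pos fun ℓ _ => div_pos (prod_pos fun p _ => hw0 _) (hNpos ℓ U)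
  have hfle : ∀ U, f U ≤ ∏ ℓ ∈ B.image t, M ^ (C ℓ).card / m ^ (C ℓ).card := fun U =>
    Finset.prod_le_prod (fun ℓ _ => (div_pos (prod_pos fun p _ => hw0 _) (hNpos ℓ U)).le) fun ℓ _ =>
      div_le_div₀ (pow_nonneg hMpos.le _) (pow_le_prodPlaquetteWeight_le_pow_anyDim hm0 hm hM (C ℓ) U).2
        (pow_pos hm0 _) (pow_le_normaliser_le_pow hw hm0 hm hM (C ℓ) ℓ U).1
  have hfm : Measurable f := Finset.measurable_prod _ fun ℓ _ =>
    ((continuous_prodPlaquetteWeight_anyDim hw (C ℓ)).measurable).div (measurable_normaliser hw (C ℓ) ℓ)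
  have hfi : Integrable f Haar := by
    refine Integrable.mono' (integrable_const (∏ ℓ ∈ B.image t, M ^ (C ℓ).card / m ^ (C ℓ).card))
      hfm.aestronglyMeasurable (ae_of_all _ fun U => ?_)
    rw [Real.norm_eq_abs, abs_of_pos (hfpos U)]
    exact hfle U
  have hint : ∫ U, f U ∂Haar = 1 :=
    integral_induced_allClosing_eq_one hw hm0 hm hM B t ht rank hrank u huB humax
  constructor
  rw [withDensity_apply _ MeasurableSet.univ, Measure.restrict_univ,
    ← ofReal_integral_eq_lintegral_ofReal hfi (ae_of_all _ fun U => (hfpos U).le), hint, ENNReal.ofReal_one]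

end Haar

end Summit.Ventures.LatticeQCDFlow.Theory2.Autoregressive

end
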